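import Literature.Geometry.Lorentzian.MassInequalities
import Literature.Geometry.Lorentzian.InverseMeanCurvatureFlow
import HarnessLib

/-!
# Mass–capacity inequalities: the capacity of a horizon and Bray's Theorem 9
(family `gr`, in support of **gr.S09** `riemannian_penrose_rigidity` and
`riemannian_penrose_inequality` of `MassInequalities.lean`; trunk G08 = T-LORENTZ; namespace
`Literature.GR`)

Bray (J. Differential Geom. 59 (2001) 177–267 = arXiv:math/9911173) proves the Riemannian Penrose
inequality `m ≥ √(A/16π)` (Thm. 1; Thm. 19 for manifolds with boundary) by his *conformal flow of
metrics* `g_t = u_t⁴ g₀` (§3, the o.d.e. before Thm. 2: `Σ(t)` is the outermost minimal area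
enclosure of the horizon `Σ₀` in `g_t`, `v_t` the `g₀`-harmonic function vanishing on and inside
`Σ(t)` and tending to `-e^{-t}` at infinity, `u_t = 1 + ∫₀ᵗ v_s ds`), along which the horizon
area `A(t)` is constant and the total mass `m(t)` is nonincreasing (Thm. 3), while `(M, g_t)`
converges to a Schwarzschild exterior (Thm. 4). The engine of both the monotonicity `m'(t) ≤ 0`
(§7, Thm. 10 and the formula for the one-sided derivatives of `m(t)` at `t = 0`, namely
`ℰ(Σ^±(0), g₀) - 2 m(0)`) and of the **case of equality** (§13, after Thm. 18:
equality in the Penrose inequality forces `d m/dt⁺ (0) = 0`, i.e. `ℰ(Σ⁺(0), g₀) = 2 m(0)`, and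
then "by the case of equality of Theorem 9, `(M³, g)` is a Schwarzschild manifold outside
`Σ⁺(0)`") is the mass–capacity theorem of §6, a consequence of the positive mass theorem by the
reflection argument of Bunting and Masood-ul-Alam:

* **Def. 17.** For a horizon `Σ ∈ 𝒮` of a complete asymptotically flat `(M³, g)`,
  `ℰ(Σ, g) = inf_φ (1/2π) ∫_{M³} |∇φ|² dV`, the infimum over all smooth `φ` which go to one at
  infinity (in the chosen end) and equal zero on the horizon `Σ` (and are zero inside `Σ`).
* **Thm. 9.** *Let `(M³, g)` be a complete, smooth, asymptotically flat `3`-manifold with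
  nonnegative scalar curvature with a horizon `Σ ∈ 𝒮` and total mass `m` (in the chosen end). Then
  `m ≥ ½ ℰ(Σ, g)`, with equality if and only if `(M³, g)` is a Schwarzschild manifold outside the
  horizon `Σ`.*

Here (§2, Defs. 3–4) `𝒮` is the collection of smooth compact boundaries `Σ = ∂G` of open sets `G`
containing the points at infinity of all ends but the chosen one, so that `Σ` divides `M` into an
inside `G` and an outside `M ∖ G` having exactly the chosen end, and a *horizon* is a zero mean
curvature surface in `𝒮` (possibly disconnected).

This file (the first of the decomposition of `riemannian_penrose_rigidity` along Bray's proof,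
see the `NOTES.md` of that fact) vendors these objects with **real definitions** and Thm. 9 as two
**named facts** (D-0014: nothing is asserted; users take `(h : <name>)`):

* `endValue e φ`, `TendstoAtEnd e φ c` — a function read in the chart of the end `e` and the
  statement "`φ → c` at infinity in the end `e`" (along `Bornology.cobounded E3`); `endValue` is
  the common pattern of `AFEnd.scalarCurvatureCoeff`/`trKCoeff` (`AsymptoticFlatness.lean`) and
  `energyDensityCoeff` (`MassInequalities.lean`): `scalarCurvatureCoeff_eq_endValue`,
  `trKCoeff_eq_endValue`, `energyDensityCoeff_eq_endValue` (`rfl`); `tendstoAtEnd_const` (proved).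
* `IsCapacityTestFn e U φ` — the test functions of Def. 17, extended by zero inside `Σ`: `φ` is
  continuous on `X`, smooth on the open outside region `U`, `φ = 0` off `U` (i.e. on `Σ` and
  inside it), and `φ → 1` at infinity in `e` (see the design notes: Bray's `φ` are smooth on the
  outside `M_Σ` up to `Σ`, and his minimiser (86) is only Lipschitz across `Σ`);
  `IsCapacityTestFn.of_contMDiff` (globally smooth functions vanishing off `U` qualify),
  `isCapacityTestFn_one_top`.
* `dirichletEnergy h φ = ∫_X |∇φ|²_h dV_h` (a lower Lebesgue integral in `ℝ≥0∞` of the square of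
  the slope `gradNorm h φ = √(h⁻¹(dφ, dφ))` of `InverseMeanCurvatureFlow.lean` against
  `dV_h = riemannianMeasure h` of `Volume.lean`); `dirichletEnergy_const` (proved).
* `horizonCapacity h e U = ℰ(Σ, g)` — Def. 17 as an `iInf` in `ℝ≥0∞` over `IsCapacityTestFn e U`;
  `horizonCapacity_le` (the infimum is below every test energy) and `horizonCapacity_top`
  (`ℰ = 0` for the empty horizon, `U = X`, via `φ ≡ 1`), proved.
* `IsOutsideOf e U f' ν'` — "`U` is the open region outside the surface `Σ = range f' ∈ 𝒮`
  towards the end `e`": `frontier U = Σ`, the normal `ν'` points into `U` and `-ν'` out of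
  `closure U` (so `U` lies on one side of `Σ`, and `Σ = ∂G` for the open inside
  `G = (closure U)ᶜ`), and `U` is the connected exterior region of `e`, compact modulo the end
  (`IsExteriorRegion`, `MassInequalities.lean`) — i.e. the outside has exactly the chosen end.
* `Bray2001_mass_ge_half_capacity` (Thm. 9, the inequality `½ ℰ(Σ, g) ≤ m`) and
  `Bray2001_capacity_rigidity` (Thm. 9, case of equality: `m = ½ ℰ(Σ, g)` with `Σ ≠ ∅` forces
  the outside `U` to be isometric to the Schwarzschild exterior
  `({m/2 < ‖y‖}, (1 + m/2‖y‖)⁴ δ)` of mass `m`, (12)) — named facts.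

## Mathlib

Mathlib (at the pin) has no capacity of sets and no harmonic or Green's functions on Riemannian
manifolds (`lean search -i --decl 'capacity'` finds nothing in Mathlib beyond `HashSet` capacities;
`InnerProductSpace.HarmonicAt` of `Mathlib/Analysis/InnerProductSpace/Harmonic/` is the flat
Laplacian `Δ f = 0` on inner product spaces, not on manifolds). Used: `ContMDiff`/`ContMDiffOn`,
`Continuous`, `Filter.Tendsto` along `Bornology.cobounded`,
`MeasureTheory.lintegral`, `iInf` in `ℝ≥0∞`, `Diffeomorph`, `innerSL ℝ`, `frontier`/`closure`,
`𝓝[>]`/`𝓝[<]`, `mfderiv`; and the Lorentz prelude: `AFEnd` (+ `dataChart`,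
`IsAsymptoticallyFlat`, `HasADMEnergy`, `admEnergy`, `scalarCurvatureCoeff`), `InitialDataSet`
(+ `IsTimeSymmetric`, `IsComplete`, `metric`), `scalarCurvature`, `innerDual`, `NormalField`,
`IsUnitNormal`, `IsSpacelikeImmersion`, `IsMaximalSlice`, `contMDiff_pullbackBilin`,
`curveThrough`, `pullbackBilin`, `exteriorRegion`, `riemannianMeasure`, `IsExteriorRegion`,
`gradNorm` (`InverseMeanCurvatureFlow.lean`).

## Design choices

* *The capacity is an infimum of energies* (no Laplacian, Green's function or Sobolev space is
  needed to state Def. 17 and Thm. 9; that the infimum is attained by the `g`-harmonic `φ` with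
  `φ = 0` on `Σ`, `φ → 1`, and `φ = 1 - ℰ/(2|x|) + O(|x|⁻²)` ((86)–(87)) is part of Bray's proof,
  not of the statements). Energies are lower Lebesgue integrals in `ℝ≥0∞` (no integrability side
  condition, no junk value); the capacity is finite (test functions equal to `1` outside a
  compact set have finite energy) and enters the facts through `ENNReal.toReal`.
* *The class of test functions.* Def. 17 takes "all smooth `φ(x)` which go to one at infinity
  and equal zero on the horizon `Σ` (and are zero inside `Σ`)" and integrates over `M³`; the
  proof of Thm. 9 works on the manifold with boundary `M_Σ` (the closed outside), and "the
  infimum … is achieved by the Green's function" (86), which is smooth on `M_Σ` up to `Σ` but,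
  extended by zero, only Lipschitz across `Σ` (`∂_ν φ > 0` on `Σ` by the Hopf lemma). So Bray's
  test functions are the `φ` smooth on `M_Σ` with `φ = 0` on `Σ`, extended by zero inside, and
  *not* the globally smooth functions vanishing off the outside (a proper subclass, vanishing to
  infinite order on `Σ`, in which the infimum is not attained). `IsCapacityTestFn` therefore asks
  for `φ : X → ℝ` continuous on `X`, smooth (`C^∞`, `ContMDiffOn`) on the open outside `U`, zero
  off `U`, and `→ 1` at infinity: this contains every test function of Bray (extended by zero)
  and his minimiser (86), and is slightly wider (no one-sided smoothness up to `Σ` is demanded;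
  continuity across `Σ` is, and is essential — the indicator of `U` has zero energy). The infimum
  over a wider class is not larger, so Thm. 9 as printed implies both named facts below
  (`½ ℰ ≤ ½ ℰ_Bray ≤ m`; and `½ ℰ = m` forces `½ ℰ_Bray = m`). The values in fact agree, by
  truncation: for a test function `φ` of finite energy and `G_δ : ℝ → ℝ` smooth with `G_δ = 0`
  on `[-δ, δ]`, `G_δ(s) = s` for `|s| ≥ 2δ`, `|G_δ'| ≤ 3`, the function `G_δ ∘ φ` vanishes on the
  neighbourhood `{|φ| < δ}` of `Σ` and of the inside, so is smooth on all of `X`, still tends to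
  `1`, and has energy at most `∫ |∇φ|² + 9 ∫_{0 < |φ| < 2δ} |∇φ|² → ∫ |∇φ|²` (`δ → 0`); hence the
  infima over Bray's class, over its subclass of globally smooth functions vanishing off `U`,
  and over `IsCapacityTestFn` coincide, and `ℰ` below is Bray's number (as (113) of the next
  file requires). The integral over `M³` is the integral over `X`; the differential `mfderiv`
  inside `gradNorm` takes the junk value `0` at points of non-differentiability of a test
  function, which lie on the `dV_h`-null surface `Σ`.
* *The class `𝒮` relative to the open-end design.* Bray compactifies the non-chosen ends and lets
  `Σ = ∂G` bound an open `G ∋ ∞_k`; the object entering Def. 17 and Thm. 9 is the outside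
  `M_Σ = M ∖ G`, which has only the chosen end. We record its interior `U` (`IsOutsideOf`):
  `Σ = frontier U` is a smoothly embedded compact surface with unit normal `ν'` pointing into `U`
  for small `t > 0` and out of `closure U` for small `t < 0` along the chart-straight curves
  `curveThrough` (the device of `OutermostMOTS.pointsInto`); then `G := (closure U)ᶜ` is open with
  `frontier G = Σ` and `U = X ∖ closure G`, recovering Bray's picture, and `IsExteriorRegion e U`
  says that the outside is connected and has exactly the end `e`. Connectedness of `U` is not
  spelled out in Def. 3 but is implicit in Thm. 9 (a compact pocket of `M ∖ G` away from the end
  would carry `φ = 0` at no cost and could not be "Schwarzschild outside `Σ`"); assuming it only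
  weakens the facts.
* *Hypotheses on `X` inside `Σ`.* Bray's `M` is asymptotically flat in the sense of Def. 21
  (finitely many ends, each asymptotically flat, the non-chosen ones inside `Σ`). The proof of
  Thm. 9 (§6: "Let `M_Σ³` be the closed region of `M³` which is outside (or on) `Σ` … reflect
  `(M_Σ³, g)` through `Σ`") and the remark before Thm. 19 ("none of the arguments in this paper
  have used anything about the original manifold inside the original horizon") use nothing
  inside `Σ`; exactly as for `riemannian_penrose_inequality`/`_rigidity` (which rest on Thm. 19 in
  the same way), the facts therefore constrain `X` inside `Σ` only through the global hypotheses
  "`X` complete, `R ≥ 0` on `X`", and put Bray's Def. 21 on the chosen end `e`: asymptotic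
  flatness of order `1` (`h - δ = O₂(r⁻¹)`, stronger than `p > 1/2`) and `|R| = O(r^{-q})`,
  `q > 3`, plus existence of the ADM energy limit ((225); `m = e.admEnergy D`, same
  normalisation `(16π)⁻¹ ∮ (g_{ij,i} - g_{ii,j}) νʲ`). The data are time-symmetric initial data
  sets `D` (`k = 0`), i.e. Riemannian `3`-manifolds `(X, h)`, as in `MassInequalities.lean`.
* *Rigidity model without `ModelData`.* As in `riemannian_penrose_rigidity`: a diffeomorphism
  `Φ : U ≅ exteriorRegion (m/2) = {m/2 < ‖y‖} ⊆ E3` with `Φ^* ((1 + m/(2‖y‖))⁴ δ) = h|_U`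
  (Bray (12); Myers–Steenrod makes the isometry smooth). Only the direction "equality ⇒
  Schwarzschild" is vendored, for `Σ ≠ ∅` (for `Σ = ∅`, `U = X`, `ℰ = 0` and Thm. 9 is the
  positive mass theorem, whose rigidity model is `ℝ³`, not a Schwarzschild exterior).
* *Instance hypotheses* as in `InverseMeanCurvatureFlow.lean`: `[LocallyCompactSpace X]` (true for
  manifolds, not an instance; gives `T3Space` for the Riemannian measure) and
  `[MeasurableSpace X] [BorelSpace X]` (users take `borel X`). The data manifold `X : Type` lives
  in universe `0` throughout, as in `MassInequalities.lean` (`IsExteriorRegion`).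

## References

* H. L. Bray, *Proof of the Riemannian Penrose inequality using the positive mass theorem*,
  J. Differential Geom. 59 (2001) 177–267 (arXiv:math/9911173): §2 Defs. 3–6 and Thm. 1 with
  (12); §3 (the conformal flow), Thms. 2–4; §6 Defs. 16–17, Thms. 8–9; §7 Thm. 10 (`m'(t) ≤ 0`);
  §13 Def. 21, (225), Thm. 18, the case of equality, Thm. 19.
* G. L. Bunting, A. K. M. Masood-ul-Alam, *Nonexistence of multiple black holes in
  asymptotically Euclidean static vacuum space-time*, Gen. Relativity Gravitation 19 (1987)
  147–154 (the reflection/conformal compactification argument behind Thms. 8–9).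
* H. L. Bray, F. Finster, *Curvature estimates and the positive mass theorem*, Comm. Anal.
  Geom. 10 (2002) 291–306, Thm. 5.3 (equality case for singular limits, used in Thm. 8).
-/

noncomputable section

open Bundle Set Manifold TopologicalSpace Filter MeasureTheory Asymptotics
open scoped ContDiff Topology ENNReal Manifold Real

namespace Literature.Geometry.Lorentzian

open PseudoRiemannianMetric

variable {X : Type} [TopologicalSpace X] [ChartedSpace E3 X]

/-! ### Functions read at infinity along an end -/

/-- The function `φ : X → ℝ` **read in the chart of the end** `e`: `φ(Φ x)` for `R < ‖x‖`
(`Φ = e.dataChart` the inverse chart), junk value `0` inside the closed ball `‖x‖ ≤ R` (invisible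
along `Bornology.cobounded E3`; the pattern of `AFEnd.scalarCurvatureCoeff`). Bray 2001, §2 and
§6 (functions "going to a constant at infinity" in an end `≅ ℝ³ ∖ B₁(0)`). [folklore] -/
def endValue (e : AFEnd X) (φ : X → ℝ) (x : E3) : ℝ :=
  if hx : e.R < ‖x‖ then φ (e.dataChart ⟨x, hx⟩) else 0

/-- Outside the ball, `endValue` is `φ` composed with the inverse chart. [folklore] -/
theorem endValue_of_lt (e : AFEnd X) (φ : X → ℝ) {x : E3} (hx : e.R < ‖x‖) :
    endValue e φ x = φ (e.dataChart ⟨x, hx⟩) :=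
  dif_pos hx

/-- Inside the closed ball `‖x‖ ≤ R`, `endValue` is the junk value `0`. [folklore] -/
theorem endValue_of_not_lt (e : AFEnd X) (φ : X → ℝ) {x : E3} (hx : ¬ e.R < ‖x‖) :
    endValue e φ x = 0 :=
  dif_neg hx

/-- **`φ` tends to `c` at infinity in the end `e`**: `φ(Φ x) → c` as `‖x‖ → ∞` in the chart of
the end (`Filter.Tendsto` of `endValue e φ` along `Bornology.cobounded E3`). This is Bray's
"`lim_{x → ∞} φ(x) = c`" in the chosen end (§3: `v_t → -e^{-t}`; §6 Defs. 16–17: `φ → 1`).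
[cite: BrayRPI2001, §6 Def. 17] -/
def TendstoAtEnd (e : AFEnd X) (φ : X → ℝ) (c : ℝ) : Prop :=
  Tendsto (endValue e φ) (Bornology.cobounded E3) (𝓝 c)

/-- A constant function read in the chart is eventually (outside the ball) that constant.
[folklore] -/
theorem endValue_const_eventuallyEq (e : AFEnd X) (c : ℝ) :
    endValue e (fun _ ↦ c) =ᶠ[Bornology.cobounded E3] fun _ ↦ c := by
  filter_upwards [eventually_cobounded_le_norm (E := E3) (e.R + 1)] with x hx
  rw [endValue_of_lt e _ (by linarith)]

/-- Constant functions tend to their value at infinity in every end. [folklore] -/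
theorem tendstoAtEnd_const (e : AFEnd X) (c : ℝ) : TendstoAtEnd e (fun _ ↦ c) c :=
  tendsto_const_nhds.congr' (endValue_const_eventuallyEq e c).symm

variable [IsManifold (𝓡 3) ∞ X]

/-! ### The chart coefficients of the Lorentz prelude as `endValue`s -/

/-- `AFEnd.scalarCurvatureCoeff` is the scalar curvature read in the chart of the end.
[folklore] -/
theorem scalarCurvatureCoeff_eq_endValue (e : AFEnd X) (D : InitialDataSet (𝓡 3) X)
    [D.metric.HasLeviCivita] : e.scalarCurvatureCoeff D = endValue e D.metric.scalarCurvature :=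
  rfl

/-- `AFEnd.trKCoeff` is the mean curvature `tr_h k` read in the chart of the end. [folklore] -/
theorem trKCoeff_eq_endValue (e : AFEnd X) (D : InitialDataSet (𝓡 3) X) :
    e.trKCoeff D = endValue e D.traceK :=
  rfl

/-- `energyDensityCoeff` is the energy density `μ` read in the chart of the end. [folklore] -/
theorem energyDensityCoeff_eq_endValue (e : AFEnd X) (D : InitialDataSet (𝓡 3) X)
    [D.metric.HasLeviCivita] : energyDensityCoeff e D = endValue e D.energyDensity :=
  rfl

/-! ### Test functions, Dirichlet energy and the capacity `ℰ(Σ, g)` of a horizon -/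

section Capacity

variable (h : ContMDiffRiemannianMetric (𝓡 3) ∞ E3 (TangentSpace (𝓡 3) : X → Type _))

/-- Bray's **test functions for the capacity of a horizon** with open outside region `U` in the
end `e` (Def. 17: "the infimum is taken over all smooth `φ(x)` which go to one at infinity and
equal zero on the horizon `Σ` (and are zero inside `Σ`)", the `φ` being smooth on the outside
`M_Σ = closure U` up to `Σ`, as the minimiser (86) is), extended by zero to `X`: `φ : X → ℝ` is
continuous, smooth on the open outside `U`, vanishes off `U` (that is, on `Σ = frontier U` and
inside), and tends to `1` at infinity in `e`. Every test function of Def. 17 and the Green's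
function (86) belong to this class; it is slightly wider than Bray's (smoothness is asked on the
open outside only, continuity across `Σ`), which does not increase the infimum `horizonCapacity`
(see the module docstring). [cite: BrayRPI2001, §6 Def. 17 with (86)] -/
def IsCapacityTestFn (e : AFEnd X) (U : Opens X) (φ : X → ℝ) : Prop :=
  Continuous φ ∧ ContMDiffOn (𝓡 3) 𝓘(ℝ, ℝ) ∞ φ (U : Set X) ∧ (∀ x, x ∉ (U : Set X) → φ x = 0) ∧
    TendstoAtEnd e φ 1

omit [IsManifold (𝓡 3) ∞ X] in
/-- Globally smooth functions vanishing off `U` and tending to `1` are test functions (the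
subclass of Def. 17 of functions vanishing to infinite order on `Σ`). [folklore] -/
theorem IsCapacityTestFn.of_contMDiff {e : AFEnd X} {U : Opens X} {φ : X → ℝ}
    (hφ : ContMDiff (𝓡 3) 𝓘(ℝ, ℝ) ∞ φ) (h0 : ∀ x, x ∉ (U : Set X) → φ x = 0)
    (h1 : TendstoAtEnd e φ 1) : IsCapacityTestFn e U φ :=
  ⟨hφ.continuous, hφ.contMDiffOn, h0, h1⟩

omit [IsManifold (𝓡 3) ∞ X] in
/-- A test function vanishes on the horizon `Σ = frontier U` (and inside). Bray 2001, Def. 17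
("equal zero on the horizon"). [cite: BrayRPI2001, §6 Def. 17] -/
theorem IsCapacityTestFn.eq_zero_of_mem_frontier {e : AFEnd X} {U : Opens X} {φ : X → ℝ}
    (hφ : IsCapacityTestFn e U φ) {x : X} (hx : x ∈ frontier (U : Set X)) : φ x = 0 :=
  hφ.2.2.1 x fun hxU ↦ (disjoint_frontier_iff_isOpen.mpr U.isOpen).le_bot ⟨hx, hxU⟩

omit [IsManifold (𝓡 3) ∞ X] in
/-- The constant `1` is a test function for the empty horizon (`U = X`: nothing to vanish on).
[folklore] -/
theorem isCapacityTestFn_one_top (e : AFEnd X) : IsCapacityTestFn e ⊤ (fun _ : X ↦ (1 : ℝ)) :=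
  IsCapacityTestFn.of_contMDiff contMDiff_const (fun _ hx ↦ (hx trivial).elim)
    (tendstoAtEnd_const e 1)

variable [T2Space X] [LocallyCompactSpace X] [MeasurableSpace X] [BorelSpace X]

/-- The **Dirichlet energy** `∫_X |∇φ|²_h dV_h` of `φ : X → ℝ` on the Riemannian `3`-manifold
`(X, h)`, as a lower Lebesgue integral in `ℝ≥0∞` (no integrability condition): the square of the
slope `|∇φ|_h = gradNorm h φ` of `InverseMeanCurvatureFlow.lean` (`√(h⁻¹(dφ_x, dφ_x))`, the
inverse metric `innerDual` on the differential `dφ_x = mfderiv φ x`, junk `0` where `φ` is not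
differentiable) against `dV_h = riemannianMeasure h` (`Volume.lean`). Bray 2001, §6, Defs. 16–17
(the integrand `|∇φ|² dV`). [cite: BrayRPI2001, §6 Defs. 16–17] -/
def dirichletEnergy (φ : X → ℝ) : ℝ≥0∞ :=
  ∫⁻ x, ENNReal.ofReal (gradNorm h φ x ^ 2) ∂(riemannianMeasure h)

/-- Constants have zero Dirichlet energy (`∇c = 0`). [folklore] -/
@[simp]
theorem dirichletEnergy_const (c : ℝ) : dirichletEnergy h (fun _ : X ↦ c) = 0 := by
  simp [dirichletEnergy]

/-- The **capacity `ℰ(Σ, g)` of the horizon `Σ = frontier U`** with open outside region `U` in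
the end `e` (Bray, Def. 17): `ℰ(Σ, g) = inf_φ (1/2π) ∫_{M³} |∇φ|² dV`, the infimum over the test
functions `IsCapacityTestFn e U` (continuous, smooth outside `Σ`, `→ 1` at infinity, `= 0` on and
inside `Σ`; see there and the module docstring for the comparison with Bray's class, which it
contains). An `iInf` in `ℝ≥0∞`; it is finite (a test function equal to `1` outside a compact set
has finite energy), and for the Schwarzschild exterior of mass `m` it equals `2m` (the minimiser
being `φ = (1 - m/2r)/(1 + m/2r)`). Bray: "the infimum … is achieved by the Green's function"
(86) (`g`-harmonic outside `Σ`, `0` on `Σ`, `→ 1`), with `φ = 1 - ℰ(Σ, g)/(2|x|) + O(|x|⁻²)`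
(87), which is how `ℰ` enters the mass; extended by zero inside `Σ`, (86) is a member of
`IsCapacityTestFn e U`. [cite: BrayRPI2001, §6 Def. 17 (85)] -/
def horizonCapacity (e : AFEnd X) (U : Opens X) : ℝ≥0∞ :=
  ⨅ (φ : X → ℝ) (_ : IsCapacityTestFn e U φ), ENNReal.ofReal (2 * π)⁻¹ * dirichletEnergy h φ

/-- The capacity is at most `(1/2π)` times the Dirichlet energy of any test function (it is their
infimum). Bray 2001, Def. 17. [cite: BrayRPI2001, §6 Def. 17] -/
theorem horizonCapacity_le (e : AFEnd X) (U : Opens X) {φ : X → ℝ}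
    (hφ : IsCapacityTestFn e U φ) :
    horizonCapacity h e U ≤ ENNReal.ofReal (2 * π)⁻¹ * dirichletEnergy h φ :=
  iInf₂_le φ hφ

/-- For the empty horizon (`U = X`) the capacity vanishes: `φ ≡ 1` is a test function of zero
energy (then Thm. 9 reads `m ≥ 0`, the positive mass theorem). [folklore] -/
theorem horizonCapacity_top (e : AFEnd X) : horizonCapacity h e ⊤ = 0 :=
  nonpos_iff_eq_zero.1 <|
    (horizonCapacity_le h e ⊤ (isCapacityTestFn_one_top e)).trans (by simp)

end Capacity

/-! ### The class `𝒮`: the outside region of a closed surface -/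

/-- **`U` is the open region outside the closed surface `f'` towards the end `e`** (Bray's class
`𝒮`, §2 Def. 3, in the open-end design: `Σ = range f'` is the boundary `∂G` of the open inside
`G = (closure U)ᶜ` and `U` is the interior of the outside `M ∖ G`, which has exactly the chosen
end): `frontier U = range f'`; the field `ν'` along `f'` (meant: the unit normal) points into `U`
— the chart-straight curve through `f' y` with velocity `ν' y` lies in `U` for small `t > 0` —
and out of `closure U` for small `t < 0` (so `U` lies on one side of each component of `Σ`); and
`U` is the exterior region of the end `e` (`IsExteriorRegion`: connected, containing `e.far R'`
for some `R' > e.R`, with `closure U ∖ e.far R'` compact). [cite: BrayRPI2001, §2 Def. 3] -/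
def IsOutsideOf (e : AFEnd X) (U : Opens X) {S' : Type*} (f' : S' → X)
    (ν' : NormalField (𝓡 3) f') : Prop :=
  frontier (U : Set X) = range f' ∧
  (∀ y, ∀ᶠ t in 𝓝[>] (0 : ℝ), curveThrough (𝓡 3) (f' y) (ν' y) t ∈ (U : Set X)) ∧
  (∀ y, ∀ᶠ t in 𝓝[<] (0 : ℝ), curveThrough (𝓡 3) (f' y) (ν' y) t ∉ closure (U : Set X)) ∧
  IsExteriorRegion e U

omit [IsManifold (𝓡 3) ∞ X] in
/-- The outside region of a surface in `𝒮` is the exterior region of the end (last clause).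
Bray 2001, §2 Def. 3. [cite: BrayRPI2001, §2 Def. 3] -/
theorem IsOutsideOf.isExteriorRegion {e : AFEnd X} {U : Opens X} {S' : Type*} {f' : S' → X}
    {ν' : NormalField (𝓡 3) f'} (hU : IsOutsideOf e U f' ν') : IsExteriorRegion e U :=
  hU.2.2.2

omit [IsManifold (𝓡 3) ∞ X] in
/-- The surface is the topological boundary of its outside region (first clause).
Bray 2001, §2 Def. 3. [cite: BrayRPI2001, §2 Def. 3] -/
theorem IsOutsideOf.frontier_eq {e : AFEnd X} {U : Opens X} {S' : Type*} {f' : S' → X}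
    {ν' : NormalField (𝓡 3) f'} (hU : IsOutsideOf e U f' ν') :
    frontier (U : Set X) = range f' :=
  hU.1

omit [IsManifold (𝓡 3) ∞ X] in
/-- The surface is disjoint from its (open) outside region. [folklore] -/
theorem IsOutsideOf.range_inter_eq_empty {e : AFEnd X} {U : Opens X} {S' : Type*}
    {f' : S' → X} {ν' : NormalField (𝓡 3) f'} (hU : IsOutsideOf e U f' ν') :
    range f' ∩ (U : Set X) = ∅ := by
  rw [← hU.frontier_eq, ← Set.disjoint_iff_inter_eq_empty]
  exact disjoint_frontier_iff_isOpen.mpr U.isOpen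

/-! ### Bray's Theorem 9 -/

/-- **Bray's mass–capacity inequality** (gr.S09 decomposition). Named fact: Bray,
J. Differential Geom. 59 (2001), Thm. 9 (§6), the inequality: *let `(M³, g)` be a complete,
smooth, asymptotically flat `3`-manifold with nonnegative scalar curvature with a horizon `Σ ∈ 𝒮`
and total mass `m` (in the chosen end); then `m ≥ ½ ℰ(Σ, g)`* (`ℰ` of Def. 17; proof by
reflecting the outside `M_Σ` through the minimal surface `Σ` and applying Thm. 8, itself the
positive mass theorem for the conformally compactified doubled manifold). Hypotheses: `k = 0`
(a Riemannian `3`-manifold); `R(h) ≥ 0` on `X`; Bray's asymptotic flatness (Def. 21) of the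
chosen end `e`: order-`1` decay `h - δ = O₂(r⁻¹)` (stronger than `p > 1/2`) and
`|R(h)| = O(r^{-q})` for some `q > 3`; completeness of `X`; existence of the ADM energy limit
((225), `m = e.admEnergy D`); a compact smoothly embedded surface `f' : S' → X` with unit normal
`ν'` and zero mean curvature (`IsMaximalSlice`: a horizon, Def. 4) whose outside region towards
`e` is `U` (`IsOutsideOf`: `Σ = frontier U ∈ 𝒮`, `U` the connected one-ended exterior region).
Nothing is assumed on `X` inside `Σ` beyond completeness and `R ≥ 0` (the proof, §6, works on
`M_Σ` only; cf. the remark before Thm. 19). Conclusion: `½ ℰ(Σ, g) ≤ m` with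
`ℰ(Σ, g) = (horizonCapacity D.h e U).toReal`.
[cite: BrayRPI2001, Thm. 9 (§6) with Def. 17, Def. 3 and Def. 21] -/
def Bray2001_mass_ge_half_capacity : Prop :=
  ∀ (X : Type) [TopologicalSpace X] [ChartedSpace E3 X] [IsManifold (𝓡 3) ∞ X] [T2Space X]
    [SecondCountableTopology X] [LocallyCompactSpace X] [ConnectedSpace X]
    [MeasurableSpace X] [BorelSpace X]
    (D : InitialDataSet (𝓡 3) X) [D.metric.HasLeviCivita] (e : AFEnd X) (U : Opens X)
    (S' : Type) [TopologicalSpace S'] [ChartedSpace (EuclideanSpace ℝ (Fin 2)) S']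
    [IsManifold (𝓡 2) ∞ S'] [CompactSpace S'] [T2Space S'] (f' : S' → X)
    (ν' : NormalField (𝓡 3) f')
    (hpb' : PseudoRiemannianMetric.contMDiff_pullbackBilin (𝓡 3) X (𝓡 2) S' ∞)
    (hf' : (ofRiemannian D.h).IsSpacelikeImmersion (𝓡 2) f'),
    D.IsTimeSymmetric → (∀ x : X, 0 ≤ D.metric.scalarCurvature x) →
    e.IsAsymptoticallyFlat D 1 →
    (∃ q : ℝ, 3 < q ∧
      (fun x ↦ e.scalarCurvatureCoeff D x) =O[Bornology.cobounded E3] fun x ↦ ‖x‖ ^ (-q)) →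
    D.IsComplete → (∃ m, e.HasADMEnergy D m) →
    Manifold.IsSmoothEmbedding (𝓡 2) (𝓡 3) ∞ f' → (ofRiemannian D.h).IsUnitNormal (𝓡 2) f' ν' 1 →
    (ofRiemannian D.h).IsMaximalSlice f' hpb' hf' ν' → IsOutsideOf e U f' ν' →
    (horizonCapacity D.h e U).toReal / 2 ≤ e.admEnergy D

/-- **Bray's mass–capacity rigidity** (gr.S09 decomposition). Named fact: Bray,
J. Differential Geom. 59 (2001), Thm. 9 (§6), the case of equality: under the hypotheses of
`Bray2001_mass_ge_half_capacity`, *equality `m = ½ ℰ(Σ, g)` holds if and only if `(M³, g)` is a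
Schwarzschild manifold outside the horizon `Σ`* (proof: equality in Thm. 8 for the doubled
manifold — zero mass of its conformal compactification, hence flatness by the positive mass
rigidity in the singular form of Bray–Finster, Thm. 5.3 — makes `g` conformally flat and
scalar-flat outside `Σ`, i.e. Schwarzschild). This is the step "`ℰ(Σ⁺(0), g₀) = 2 m(0)` ⇒
Schwarzschild outside `Σ⁺(0)`" of the case of equality of the Riemannian Penrose inequality
(§13). Only the direction "equality ⇒ Schwarzschild" is vendored, for a *nonempty* horizon
(`Nonempty S'`; for `Σ = ∅` the capacity is `0`, `horizonCapacity_top`, and the model would be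
`ℝ³`). Conclusion, as in `riemannian_penrose_rigidity`: a diffeomorphism `Φ` of the outside region
`U` onto `exteriorRegion (m/2) = {m/2 < ‖y‖} ⊆ E3`, `m = e.admEnergy D`, with
`Φ^* ((1 + m/(2‖y‖))⁴ δ) = h` on `U` (the Schwarzschild manifold (12) of mass `m` outside its
horizon `r = m/2`; the mass parameter is `m` since the total mass is an isometry invariant of the
end; the isometry is smooth by Myers–Steenrod). In particular `Σ` is then connected.
[cite: BrayRPI2001, Thm. 9 (§6) equality case with (12)] -/
def Bray2001_capacity_rigidity : Prop :=
  ∀ (X : Type) [TopologicalSpace X] [ChartedSpace E3 X] [IsManifold (𝓡 3) ∞ X] [T2Space X]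
    [SecondCountableTopology X] [LocallyCompactSpace X] [ConnectedSpace X]
    [MeasurableSpace X] [BorelSpace X]
    (D : InitialDataSet (𝓡 3) X) [D.metric.HasLeviCivita] (e : AFEnd X) (U : Opens X)
    (S' : Type) [TopologicalSpace S'] [ChartedSpace (EuclideanSpace ℝ (Fin 2)) S']
    [IsManifold (𝓡 2) ∞ S'] [CompactSpace S'] [T2Space S'] (f' : S' → X)
    (ν' : NormalField (𝓡 3) f')
    (hpb' : PseudoRiemannianMetric.contMDiff_pullbackBilin (𝓡 3) X (𝓡 2) S' ∞)
    (hf' : (ofRiemannian D.h).IsSpacelikeImmersion (𝓡 2) f'),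
    D.IsTimeSymmetric → (∀ x : X, 0 ≤ D.metric.scalarCurvature x) →
    e.IsAsymptoticallyFlat D 1 →
    (∃ q : ℝ, 3 < q ∧
      (fun x ↦ e.scalarCurvatureCoeff D x) =O[Bornology.cobounded E3] fun x ↦ ‖x‖ ^ (-q)) →
    D.IsComplete → (∃ m, e.HasADMEnergy D m) →
    Manifold.IsSmoothEmbedding (𝓡 2) (𝓡 3) ∞ f' → (ofRiemannian D.h).IsUnitNormal (𝓡 2) f' ν' 1 →
    (ofRiemannian D.h).IsMaximalSlice f' hpb' hf' ν' → IsOutsideOf e U f' ν' → Nonempty S' →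
    (horizonCapacity D.h e U).toReal / 2 = e.admEnergy D →
    ∃ Φ : Diffeomorph (𝓡 3) (𝓡 3) U (exteriorRegion (e.admEnergy D / 2)) ∞,
      ∀ x : U, pullbackBilin (I := 𝓡 3) (I' := 𝓡 3) Φ
        (fun y ↦ (1 + e.admEnergy D / (2 * ‖(y : E3)‖)) ^ 4 •
          (innerSL ℝ (E := E3) : E3 →L[ℝ] E3 →L[ℝ] ℝ)) x = D.metric.val x.1

/-! ### Test functions: accessors and an upper bound for the capacity -/

section CapacityAPI

variable {e : AFEnd X} {U : Opens X} {φ : X → ℝ}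

omit [IsManifold (𝓡 3) ∞ X] in
/-- A test function is continuous on `X` (first clause). Bray 2001, Def. 17.
[cite: BrayRPI2001, §6 Def. 17] -/
theorem IsCapacityTestFn.continuous (hφ : IsCapacityTestFn e U φ) : Continuous φ :=
  hφ.1

omit [IsManifold (𝓡 3) ∞ X] in
/-- A test function is smooth on the open outside region `U` (second clause). Bray 2001, Def. 17.
[cite: BrayRPI2001, §6 Def. 17] -/
theorem IsCapacityTestFn.contMDiffOn (hφ : IsCapacityTestFn e U φ) :
    ContMDiffOn (𝓡 3) 𝓘(ℝ, ℝ) ∞ φ (U : Set X) :=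
  hφ.2.1

omit [IsManifold (𝓡 3) ∞ X] in
/-- A test function tends to `1` at infinity in the end `e` (last clause). Bray 2001, Def. 17.
[cite: BrayRPI2001, §6 Def. 17] -/
theorem IsCapacityTestFn.tendstoAtEnd (hφ : IsCapacityTestFn e U φ) : TendstoAtEnd e φ 1 :=
  hφ.2.2.2

variable [T2Space X] [LocallyCompactSpace X] [MeasurableSpace X] [BorelSpace X]
  (h : ContMDiffRiemannianMetric (𝓡 3) ∞ E3 (TangentSpace (𝓡 3) : X → Type _))

/-- **Upper bounds for the capacity from globally smooth test functions**: if `φ` is smooth on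
`X`, vanishes off `U` and tends to `1` in `e`, then `ℰ(Σ, g) ≤ (1/2π) ∫_X |∇φ|² dV` (the subclass
of Def. 17 used for comparison functions). Bray 2001, Def. 17. [cite: BrayRPI2001, §6 Def. 17] -/
theorem horizonCapacity_le_of_contMDiff (e : AFEnd X) (U : Opens X) {φ : X → ℝ}
    (hφ : ContMDiff (𝓡 3) 𝓘(ℝ, ℝ) ∞ φ) (h0 : ∀ x, x ∉ (U : Set X) → φ x = 0)
    (h1 : TendstoAtEnd e φ 1) :
    horizonCapacity h e U ≤ ENNReal.ofReal (2 * π)⁻¹ * dirichletEnergy h φ :=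
  horizonCapacity_le h e U (IsCapacityTestFn.of_contMDiff hφ h0 h1)

end CapacityAPI

end Literature.Geometry.Lorentzian

end
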